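/-
Copyright (c) 2026 the pub-hodgecm-mathlib formalisation cell (harness21).  Track B «K2-LIT» prover seat hodgecm-mathlib-K2E3-p21 (g0), 2026-09-03: (S)-WILD, third rung —
the HOROCYCLE ∕ HOROSPHERE ∕ ORBIT-DATA layer of the `U(3)` lattice tree at a RAMIFIED QUADRATIC DATUM of ANY residue characteristic (the `|2| < 1` twins of ★ R3
`UnitaryLatticeTreeHorocycleStepsOfInvolution` §3, ★ A-II-RAM `UnitaryLatticeTreeHorosphereTransversalRamified` and ★ `UnitaryLatticeTreeOrbitsViaApartmentOfInvolution` §5 —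
one-line specialisations of their `_of_involution` heads once (H2)∕(H3) exist at the datum: ★ p855152, ★ p855185).
-/
import Literature.NumberTheory.Automorphic.UnitaryLatticeTreeHorocycleRootStarWild          -- ★ p855152 (this seat): (H2) at the datum `…_of_adj_zero_of_ramified`; brings ★ R1
import Literature.NumberTheory.Automorphic.UnitaryLatticeTreeHorocycleTypeTwoStarWild       -- ★ p855185 (this seat): (H3) at the datum `…_of_adj_neg_one_of_ramified`
import Literature.NumberTheory.Automorphic.UnitaryLatticeTreeHorocycleStepsOfInvolution     -- ★ R3 (F0P2-p01 (g27)): (S) `eq_apartmentEnum_sub_one_or_exists_mem_unipotentU_of_adj_of_involution` (hypothesis-style `hH2`, `hH3`)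
import Literature.NumberTheory.Automorphic.UnitaryLatticeTreeOrbitsViaApartmentOfInvolution -- ★ (F0P2-p01 (g27)): `exists_vertexOrbitData_of_involution` &c.; brings ★ (T-I) `…HorosphereTransversalOfInvolution` (the twelve `_of_involution` heads)
import Literature.NumberTheory.Automorphic.UnitaryLatticeTreeEulerRelationWild              -- ★ p854681 (LH4-p01 (g17)): `isTree_latticeGraph_three_of_ramified` (the lattice graph is a tree at every ramified quadratic datum)
import Literature.NumberTheory.Automorphic.UnitaryThreeFourFrameDefs                        -- ★ p854559 (B-p04): the datum token `IsRamifiedQuadraticDatum σ ϖ d t`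
import HarnessLib
/-!
# Horocycle steps of the `U(3)` tree at a RAMIFIED QUADRATIC DATUM (tame or WILD), III: the star dichotomy (S) at every apartment vertex, the HOROSPHERE
# TRANSVERSALS (H5)–(H8) and the VERTEX ∕ EDGE ORBIT DATA, unconditionally (Bruhat–Tits 1972 §10, (4.4.4), (7.4.18); Tits 1979 §2.7, §3.3.3; Serre, *Trees* I §2.2, I §6.4, II §1.1)

THE SETTING.  `K` a valued field with finite residue field, `σ` an isometric involution (`hσ`, `hvσ`), `ϖ` ANY uniformiser (`hϖ`), `J₀ = antidiag(1,1,1)`, `U = U(σ, J₀)` acting on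
the lattice tree by ★ `latticeGraphIso`; `B ≥ T, N` the upper Borel, its diagonal torus and unipotent radical (★ `borelU ∕ torusU ∕ unipotentU`); the enumerated standard apartment
`A : ℤ → 𝓥` (HYPOTHESIS-STYLE `(A, hA0, hA1)`).  The RAMIFIED letters are those of Track A's datum `IsRamifiedQuadraticDatum σ ϖ d t` (★ `UnitaryThreeFourFrameDefs`): `heven`,
`hd : |ϖ − σϖ| = |ϖ|^d`, `1 ≤ d`, `h2t : |2| = |ϖ|^t` — NO `σϖ = −ϖ`, NO `|2| = 1`, NO norm hypothesis; `[ValuativeRel K] [Valued.v.Compatible]` where the ★ tree lemma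
`isTree_latticeGraph_three_of_ramified` lives (as in ★ A-II-RAM).
Cell `pub/hodgecm-mathlib` (D-0151), crux H413 = `stmt-HodgeConjecture-24833`, lane `--supports …`; Track B «K2-LIT» engine E3 (K2E3-plan (g1), seat K2E3-p21: the (X0′)∕EP-NORM-ONE tower
at a wild place, feasibility word K2/STATUS 22:06:26Z), junction Track A LH4 «(D-RAM) FOUR-FRAME» unit U0.  Topic `NumberTheory/Automorphic`; namespace
`Literature.NumberTheory.Automorphic.UnitaryLatticeTree`.  THEOREMS ONLY (no definition, no instance, no notation, no named fact, no `sorry`).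

WHAT IS NEW.  Nothing mathematical: ★ R3's (S) and ★ (T-I)'s (H5)–(H8) and ★ §4's orbit data are `_of_involution` heads with exactly two place inputs — `hT` (the lattice graph is a tree)
and `hH4` (the star dichotomy), the latter built by ★ R3 from `hH2` (root-star step) and `hH3` (type-two-star step).  At a TAMELY ramified place ★ R1∕R2 supply `hH2`∕`hH3` with `2⁻¹`
and `σϖ = −ϖ`; at a ramified datum of ANY residue characteristic files I∕II of this seat (★ p855152 `…_of_adj_zero_of_ramified`, ★ p855185 `…_of_adj_neg_one_of_ramified`) supply
them, and ★ p854681 `isTree_latticeGraph_three_of_ramified` supplies `hT`.  This file is the token pass `(hσϖ hres h2 hnorm) ↦ (heven hd h1d h2t)` over ★ A-II-RAM and ★ §5 of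
`…OrbitsViaApartmentOfInvolution`, conclusions VERBATIM, names `…_of_neg ↦ …_of_ramified`; §4 re-issues the consumer heads in the datum token's shape (`hD : IsRamifiedQuadraticDatum σ ϖ d t`).
CONSUMERS: the wild twins of the Summits-side datum files of the EP tower (55-B, (A), Borel–Iwahori, 61b, 41g-H, 58-W, 72–73, 80; census K2/STATUS 22:06:26Z).
HONEST LABEL: count-neutral generic lattice-tree layer; re-proves the tame case (`t = 0`), NEW at dyadic places (`t ≥ 1`); h413 OPEN; HC_CM is proved only modulo the 7 printed
citations (2 remaining named inputs hLiu418 = `stmt-HodgeConjecture-24832`, h413 = `stmt-HodgeConjecture-24833`) until rung 0 closes; nothing printed is asserted here.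

THIS FILE.
* §1 **(S-ram)** `eq_apartmentEnum_sub_one_or_exists_mem_unipotentU_of_adj_of_ramified` — the star dichotomy at every `A j` (★ R3 `_of_involution` ∘ (★ p855152, ★ p855185)).
* §2 **(H5)–(H8)-ram** — the eleven heads of ★ A-II-RAM re-lettered: `exists_mem_unipotentU_latticeGraphIso_apartmentEnum_eq_of_ramified` (H5), `eq_of_mem_unipotentU_of_…_eq(_₂)_of_ramified`,
  `existsUnique_apartmentEnum_index_of_ramified` (H6), `…_of_adj_of_ramified`, `…sym2Map…`, `…mapEdgeSet…` (H7) with their uniqueness forms, `exists_torusU_mul_unipotentU_of_mem_borelU_…_of_ramified` (H8).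
* §3 **orbit data** — the six heads of ★ `…OrbitsViaApartmentOfInvolution` §5 re-lettered: `exists_latticeGraphIso_apartmentEnum_zero_eq_or_one_eq_of_ramified`, `…sym2Map…zero_one…of_adj_of_ramified`,
  `…zero_one_eq_of_adj_of_ramified`, `…mapEdgeSet…zero_one_eq_of_ramified`, `exists_vertexOrbitData_of_ramified`, `exists_edgeOrbitData_of_ramified`.
* §4 **datum-token heads** (`K : Type`): `…_of_adj_of_isRamifiedQuadraticDatum` (S), `exists_vertexOrbitData_of_isRamifiedQuadraticDatum`, `exists_edgeOrbitData_of_isRamifiedQuadraticDatum`.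

## References
* [BruhatTits1972] F. Bruhat, J. Tits, *Groupes réductifs sur un corps local I*, Publ. Math. IHÉS 41 (1972), §10 (lattice models of the classical groups), (4.4.4), (7.4.18).
* [Tits1979] J. Tits, *Reductive groups over local fields*, PSPM 33.1 (1979), §2.7 (p. 48), §2.10 (p. 49), §3.3.3.
* [Serre1980Trees] J.-P. Serre, *Trees* (1980), Ch. II §1.1, Ch. I §2.2 Prop. 8, Ch. I §6.4.
* [Rogawski1990] J. D. Rogawski, *Automorphic Representations of Unitary Groups in Three Variables* (1990), §1.10 p. 9, §4.5 p. 45.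
-/

set_option autoImplicit false

noncomputable section

open scoped Valued WithZero Matrix MatrixGroups

namespace Literature.NumberTheory.Automorphic.UnitaryLatticeTree

open _root_.SimpleGraph Literature.NumberTheory.Automorphic Literature.NumberTheory.Automorphic.HermitianLattice
open Literature.NumberTheory.Automorphic.UnitaryGroup
open Literature.NumberTheory.Automorphic.CartanUnique (uniformizer_ne_zero)
open Literature.NumberTheory.Automorphic.UnitaryThreeFourFrame

variable {K : Type*} [Field K] [Valued K ℤᵐ⁰] {σ : K →+* K} {ϖ : K}

/-! ## §1 (S) The star dichotomy at every apartment vertex, at a ramified quadratic datum -/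

/-- **(H4)∕(S) AT A RAMIFIED QUADRATIC DATUM (tame or WILD) — THE STAR DICHOTOMY, UNCONDITIONALLY**: a neighbour `y` of `A j` is EITHER `A (j − 1)` OR `n · A (j + 1)` for some
`n ∈ N` fixing `A j`.  ★ R3's hypothesis-style `…_of_adj_of_involution` with `hH2 :=` ★ p855152 `exists_mem_unipotentU_apply_apartmentEnum_one_eq_of_adj_zero_of_ramified` and
`hH3 :=` ★ p855185 `exists_mem_unipotentU_apply_apartmentEnum_zero_eq_of_adj_neg_one_of_ramified`; letters `(hσ hvσ hϖ heven hd h1d h2t)`, `[Finite 𝓀[K]]`.  Conclusion VERBATIM =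
★ (H4)'s ∕ ★ R3 `…_of_adj_of_neg`'s — the `hH4` binder of every `_of_involution` head of the horosphere ∕ orbit layer, now at `|2| < 1`. [cite: BruhatTits1972, (4.4.4) and §10]
[cite: Tits1979, §2.7 (p. 48), §2.10 (p. 49)] [cite: Serre1980Trees, II.1.1] [cite: Rogawski1990, §1.10 p. 9] -/
theorem eq_apartmentEnum_sub_one_or_exists_mem_unipotentU_of_adj_of_ramified [Finite 𝓀[K]] (hσ : ∀ x, σ (σ x) = x) (hvσ : ∀ a, Valued.v (σ a) = Valued.v a)
    (hϖ : Valued.v ϖ = WithZero.exp (-1 : ℤ)) (heven : ∀ x : K, σ x = x → x ≠ 0 → ∃ n : ℤ, Valued.v x = WithZero.exp (2 * n)) {d t : ℕ}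
    (hd : Valued.v (ϖ - σ ϖ) = Valued.v ϖ ^ d) (h1d : 1 ≤ d) (h2t : Valued.v (2 : K) = Valued.v ϖ ^ t)
    (A : ℤ → {M : Submodule 𝒪[K] (Fin 3 → K) // IsVertex σ ϖ ((StdForm.antidiagonal 3).over K) M})
    (hA0 : ∀ a : ℤ, (A (2 * a)).1 = latt (Matrix.diagonal ![ϖ ^ a, (1 : K), ϖ ^ (-a)]))
    (hA1 : ∀ a : ℤ, (A (2 * a + 1)).1 = latt (Matrix.diagonal ![ϖ ^ (a + 1), (1 : K), ϖ ^ (-a)]))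
    (j : ℤ)
    {y : {M : Submodule 𝒪[K] (Fin 3 → K) // IsVertex σ ϖ ((StdForm.antidiagonal 3).over K) M}}
    (hy : (latticeGraph σ ϖ ((StdForm.antidiagonal 3).over K)).Adj (A j) y) :
    y = A (j - 1) ∨ ∃ n : unitaryGroupOfForm σ ((StdForm.antidiagonal 3).over K), n ∈ unipotentU σ ((StdForm.antidiagonal 3).over K) ∧
      latticeGraphIso σ ϖ ((StdForm.antidiagonal 3).over K) n (A j) = A j ∧ latticeGraphIso σ ϖ ((StdForm.antidiagonal 3).over K) n (A (j + 1)) = y :=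
  eq_apartmentEnum_sub_one_or_exists_mem_unipotentU_of_adj_of_involution hσ hvσ hϖ A hA0 hA1
    (fun _ hy₀ hy₀' => exists_mem_unipotentU_apply_apartmentEnum_one_eq_of_adj_zero_of_ramified hσ hvσ hϖ heven hd h1d h2t A hA0 hA1 hy₀ hy₀')
    (fun _ hy₀ hy₀' => exists_mem_unipotentU_apply_apartmentEnum_zero_eq_of_adj_neg_one_of_ramified hσ hvσ hϖ heven hd h1d h2t A hA0 hA1 hy₀ hy₀') j hy

section Sheet

variable [ValuativeRel K] [(Valued.v : Valuation K ℤᵐ⁰).Compatible]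

/-! ## §2 The horosphere transversals (H5)–(H8) at a ramified quadratic datum (★ A-II-RAM re-lettered `(hσϖ hres h2 hnorm) ↦ (heven hd h1d h2t)`) -/

/-- **(H5) AT A RAMIFIED QUADRATIC DATUM (tame or wild), UNCONDITIONALLY — every vertex is `n · A j`, `n ∈ N`** (`hT` ↦ ★ `isTree_latticeGraph_three_of_ramified`, `hH4` ↦ (S)-ram `…_of_adj_of_ramified`).
Conclusion VERBATIM = ★ (H5)'s. [cite: BruhatTits1972, §10] [cite: Tits1979, §2.4] [cite: Serre1980Trees, II.1.1] -/
theorem exists_mem_unipotentU_latticeGraphIso_apartmentEnum_eq_of_ramified (hσ : ∀ x, σ (σ x) = x) (hvσ : ∀ a, Valued.v (σ a) = Valued.v a) (hϖ : Valued.v ϖ = WithZero.exp (-1 : ℤ)) 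
    (heven : ∀ x : K, σ x = x → x ≠ 0 → ∃ n : ℤ, Valued.v x = WithZero.exp (2 * n)) {d t : ℕ}
    (hd : Valued.v (ϖ - σ ϖ) = Valued.v ϖ ^ d) (h1d : 1 ≤ d) (h2t : Valued.v (2 : K) = Valued.v ϖ ^ t) [Finite 𝓀[K]]
    (A : ℤ → {M : Submodule 𝒪[K] (Fin 3 → K) // IsVertex σ ϖ ((StdForm.antidiagonal 3).over K) M})
    (hA0 : ∀ a : ℤ, (A (2 * a)).1 = latt (Matrix.diagonal ![ϖ ^ a, (1 : K), ϖ ^ (-a)]))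
    (hA1 : ∀ a : ℤ, (A (2 * a + 1)).1 = latt (Matrix.diagonal ![ϖ ^ (a + 1), (1 : K), ϖ ^ (-a)]))
    (x : {M : Submodule 𝒪[K] (Fin 3 → K) // IsVertex σ ϖ ((StdForm.antidiagonal 3).over K) M}) :
    ∃ n : unitaryGroupOfForm σ ((StdForm.antidiagonal 3).over K), n ∈ unipotentU σ ((StdForm.antidiagonal 3).over K) ∧
      ∃ j : ℤ, latticeGraphIso σ ϖ ((StdForm.antidiagonal 3).over K) n (A j) = x :=
  exists_mem_unipotentU_latticeGraphIso_apartmentEnum_eq_of_involution A (isTree_latticeGraph_three_of_ramified hσ hvσ hϖ heven hd h1d h2t)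
    (fun j _ hy => eq_apartmentEnum_sub_one_or_exists_mem_unipotentU_of_adj_of_ramified hσ hvσ hϖ heven hd h1d h2t A hA0 hA1 j hy) x

/-! ### §2.2 (H6) UNIQUENESS at a ramified quadratic datum -/

/-- **(H6) AT A RAMIFIED QUADRATIC DATUM (tame or wild) — `n · A i = A j`, `n ∈ N` ⇒ `i = j`.**  Conclusion VERBATIM = ★ (H6)'s. [cite: BruhatTits1972, §10] [cite: Tits1979, §2.4] [cite: Serre1980Trees, II.1.1] -/
theorem eq_of_mem_unipotentU_of_latticeGraphIso_apartmentEnum_eq_of_ramified (hσ : ∀ x, σ (σ x) = x) (hvσ : ∀ a, Valued.v (σ a) = Valued.v a) (hϖ : Valued.v ϖ = WithZero.exp (-1 : ℤ)) 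
    (heven : ∀ x : K, σ x = x → x ≠ 0 → ∃ n : ℤ, Valued.v x = WithZero.exp (2 * n)) {d t : ℕ}
    (hd : Valued.v (ϖ - σ ϖ) = Valued.v ϖ ^ d) (h1d : 1 ≤ d) (h2t : Valued.v (2 : K) = Valued.v ϖ ^ t) [Finite 𝓀[K]]
    (A : ℤ → {M : Submodule 𝒪[K] (Fin 3 → K) // IsVertex σ ϖ ((StdForm.antidiagonal 3).over K) M})
    (hA0 : ∀ a : ℤ, (A (2 * a)).1 = latt (Matrix.diagonal ![ϖ ^ a, (1 : K), ϖ ^ (-a)]))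
    (hA1 : ∀ a : ℤ, (A (2 * a + 1)).1 = latt (Matrix.diagonal ![ϖ ^ (a + 1), (1 : K), ϖ ^ (-a)]))
    {n : unitaryGroupOfForm σ ((StdForm.antidiagonal 3).over K)}
    (hn : n ∈ unipotentU σ ((StdForm.antidiagonal 3).over K)) {i j : ℤ} (h : latticeGraphIso σ ϖ ((StdForm.antidiagonal 3).over K) n (A i) = A j) :
    i = j :=
  eq_of_mem_unipotentU_of_latticeGraphIso_apartmentEnum_eq_of_involution hσ hvσ hϖ A hA0 hA1 (isTree_latticeGraph_three_of_ramified hσ hvσ hϖ heven hd h1d h2t) hn h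

/-- **(H6₂) AT A RAMIFIED QUADRATIC DATUM (tame or wild) — two-element form.**  Conclusion VERBATIM = ★'s. [cite: BruhatTits1972, §10] [cite: Tits1979, §2.4] [cite: Serre1980Trees, II.1.1] -/
theorem eq_of_mem_unipotentU_of_latticeGraphIso_apartmentEnum_eq₂_of_ramified (hσ : ∀ x, σ (σ x) = x) (hvσ : ∀ a, Valued.v (σ a) = Valued.v a) (hϖ : Valued.v ϖ = WithZero.exp (-1 : ℤ)) 
    (heven : ∀ x : K, σ x = x → x ≠ 0 → ∃ n : ℤ, Valued.v x = WithZero.exp (2 * n)) {d t : ℕ}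
    (hd : Valued.v (ϖ - σ ϖ) = Valued.v ϖ ^ d) (h1d : 1 ≤ d) (h2t : Valued.v (2 : K) = Valued.v ϖ ^ t) [Finite 𝓀[K]]
    (A : ℤ → {M : Submodule 𝒪[K] (Fin 3 → K) // IsVertex σ ϖ ((StdForm.antidiagonal 3).over K) M})
    (hA0 : ∀ a : ℤ, (A (2 * a)).1 = latt (Matrix.diagonal ![ϖ ^ a, (1 : K), ϖ ^ (-a)]))
    (hA1 : ∀ a : ℤ, (A (2 * a + 1)).1 = latt (Matrix.diagonal ![ϖ ^ (a + 1), (1 : K), ϖ ^ (-a)]))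
    {n n' : unitaryGroupOfForm σ ((StdForm.antidiagonal 3).over K)}
    (hn : n ∈ unipotentU σ ((StdForm.antidiagonal 3).over K)) (hn' : n' ∈ unipotentU σ ((StdForm.antidiagonal 3).over K)) {i j : ℤ}
    (h : latticeGraphIso σ ϖ ((StdForm.antidiagonal 3).over K) n (A i) = latticeGraphIso σ ϖ ((StdForm.antidiagonal 3).over K) n' (A j)) : i = j :=
  eq_of_mem_unipotentU_of_latticeGraphIso_apartmentEnum_eq₂_of_involution hσ hvσ hϖ A hA0 hA1 (isTree_latticeGraph_three_of_ramified hσ hvσ hϖ heven hd h1d h2t) hn hn' h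

/-- **(H6!) AT A RAMIFIED QUADRATIC DATUM (tame or wild) — THE APARTMENT INDEX (height) OF A VERTEX, UNCONDITIONALLY.**  Conclusion VERBATIM = ★ `existsUnique_apartmentEnum_index`'s. [cite: BruhatTits1972, §10] [cite: Tits1979, §2.4] [cite: Serre1980Trees, II.1.1] -/
theorem existsUnique_apartmentEnum_index_of_ramified (hσ : ∀ x, σ (σ x) = x) (hvσ : ∀ a, Valued.v (σ a) = Valued.v a) (hϖ : Valued.v ϖ = WithZero.exp (-1 : ℤ)) 
    (heven : ∀ x : K, σ x = x → x ≠ 0 → ∃ n : ℤ, Valued.v x = WithZero.exp (2 * n)) {d t : ℕ}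
    (hd : Valued.v (ϖ - σ ϖ) = Valued.v ϖ ^ d) (h1d : 1 ≤ d) (h2t : Valued.v (2 : K) = Valued.v ϖ ^ t) [Finite 𝓀[K]]
    (A : ℤ → {M : Submodule 𝒪[K] (Fin 3 → K) // IsVertex σ ϖ ((StdForm.antidiagonal 3).over K) M})
    (hA0 : ∀ a : ℤ, (A (2 * a)).1 = latt (Matrix.diagonal ![ϖ ^ a, (1 : K), ϖ ^ (-a)]))
    (hA1 : ∀ a : ℤ, (A (2 * a + 1)).1 = latt (Matrix.diagonal ![ϖ ^ (a + 1), (1 : K), ϖ ^ (-a)]))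
    (x : {M : Submodule 𝒪[K] (Fin 3 → K) // IsVertex σ ϖ ((StdForm.antidiagonal 3).over K) M}) :
    ∃! j : ℤ, ∃ n : unitaryGroupOfForm σ ((StdForm.antidiagonal 3).over K), n ∈ unipotentU σ ((StdForm.antidiagonal 3).over K) ∧
      latticeGraphIso σ ϖ ((StdForm.antidiagonal 3).over K) n (A j) = x :=
  existsUnique_apartmentEnum_index_of_involution hσ hvσ hϖ A hA0 hA1 (isTree_latticeGraph_three_of_ramified hσ hvσ hϖ heven hd h1d h2t)
    (fun j _ hy => eq_apartmentEnum_sub_one_or_exists_mem_unipotentU_of_adj_of_ramified hσ hvσ hϖ heven hd h1d h2t A hA0 hA1 j hy) x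

/-! ### §2.3 (H7) EDGES at a ramified quadratic datum -/

/-- **(H7) AT A RAMIFIED QUADRATIC DATUM (tame or wild) — every edge is `n · {A j, A (j+1)}`, oriented form, unconditionally.**  Conclusion VERBATIM = ★'s. [cite: BruhatTits1972, §10] [cite: Tits1979, §2.4] [cite: Serre1980Trees, II.1.1] -/
theorem exists_mem_unipotentU_latticeGraphIso_apartmentEnum_eq_of_adj_of_ramified (hσ : ∀ x, σ (σ x) = x) (hvσ : ∀ a, Valued.v (σ a) = Valued.v a) (hϖ : Valued.v ϖ = WithZero.exp (-1 : ℤ)) 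
    (heven : ∀ x : K, σ x = x → x ≠ 0 → ∃ n : ℤ, Valued.v x = WithZero.exp (2 * n)) {d t : ℕ}
    (hd : Valued.v (ϖ - σ ϖ) = Valued.v ϖ ^ d) (h1d : 1 ≤ d) (h2t : Valued.v (2 : K) = Valued.v ϖ ^ t) [Finite 𝓀[K]]
    (A : ℤ → {M : Submodule 𝒪[K] (Fin 3 → K) // IsVertex σ ϖ ((StdForm.antidiagonal 3).over K) M})
    (hA0 : ∀ a : ℤ, (A (2 * a)).1 = latt (Matrix.diagonal ![ϖ ^ a, (1 : K), ϖ ^ (-a)]))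
    (hA1 : ∀ a : ℤ, (A (2 * a + 1)).1 = latt (Matrix.diagonal ![ϖ ^ (a + 1), (1 : K), ϖ ^ (-a)]))
    {x y : {M : Submodule 𝒪[K] (Fin 3 → K) // IsVertex σ ϖ ((StdForm.antidiagonal 3).over K) M}}
    (hxy : (latticeGraph σ ϖ ((StdForm.antidiagonal 3).over K)).Adj x y) :
    ∃ n : unitaryGroupOfForm σ ((StdForm.antidiagonal 3).over K), n ∈ unipotentU σ ((StdForm.antidiagonal 3).over K) ∧ ∃ j : ℤ,
      (latticeGraphIso σ ϖ ((StdForm.antidiagonal 3).over K) n (A j) = x ∧ latticeGraphIso σ ϖ ((StdForm.antidiagonal 3).over K) n (A (j + 1)) = y) ∨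
      (latticeGraphIso σ ϖ ((StdForm.antidiagonal 3).over K) n (A (j + 1)) = x ∧ latticeGraphIso σ ϖ ((StdForm.antidiagonal 3).over K) n (A j) = y) :=
  exists_mem_unipotentU_latticeGraphIso_apartmentEnum_eq_of_adj_of_involution A (isTree_latticeGraph_three_of_ramified hσ hvσ hϖ heven hd h1d h2t)
    (fun j _ hy => eq_apartmentEnum_sub_one_or_exists_mem_unipotentU_of_adj_of_ramified hσ hvσ hϖ heven hd h1d h2t A hA0 hA1 j hy) hxy

/-- **(H7s) AT A RAMIFIED QUADRATIC DATUM (tame or wild) — `Sym2` form, unconditionally.**  Conclusion VERBATIM = ★'s. [cite: BruhatTits1972, §10] [cite: Tits1979, §2.4] [cite: Serre1980Trees, II.1.1] -/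
theorem exists_mem_unipotentU_sym2Map_apartmentEnum_eq_of_adj_of_ramified (hσ : ∀ x, σ (σ x) = x) (hvσ : ∀ a, Valued.v (σ a) = Valued.v a) (hϖ : Valued.v ϖ = WithZero.exp (-1 : ℤ)) 
    (heven : ∀ x : K, σ x = x → x ≠ 0 → ∃ n : ℤ, Valued.v x = WithZero.exp (2 * n)) {d t : ℕ}
    (hd : Valued.v (ϖ - σ ϖ) = Valued.v ϖ ^ d) (h1d : 1 ≤ d) (h2t : Valued.v (2 : K) = Valued.v ϖ ^ t) [Finite 𝓀[K]]
    (A : ℤ → {M : Submodule 𝒪[K] (Fin 3 → K) // IsVertex σ ϖ ((StdForm.antidiagonal 3).over K) M})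
    (hA0 : ∀ a : ℤ, (A (2 * a)).1 = latt (Matrix.diagonal ![ϖ ^ a, (1 : K), ϖ ^ (-a)]))
    (hA1 : ∀ a : ℤ, (A (2 * a + 1)).1 = latt (Matrix.diagonal ![ϖ ^ (a + 1), (1 : K), ϖ ^ (-a)]))
    {x y : {M : Submodule 𝒪[K] (Fin 3 → K) // IsVertex σ ϖ ((StdForm.antidiagonal 3).over K) M}}
    (hxy : (latticeGraph σ ϖ ((StdForm.antidiagonal 3).over K)).Adj x y) :
    ∃ n : unitaryGroupOfForm σ ((StdForm.antidiagonal 3).over K), n ∈ unipotentU σ ((StdForm.antidiagonal 3).over K) ∧ ∃ j : ℤ,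
      Sym2.map (latticeGraphIso σ ϖ ((StdForm.antidiagonal 3).over K) n) s(A j, A (j + 1)) = s(x, y) :=
  exists_mem_unipotentU_sym2Map_apartmentEnum_eq_of_adj_of_involution A (isTree_latticeGraph_three_of_ramified hσ hvσ hϖ heven hd h1d h2t)
    (fun j _ hy => eq_apartmentEnum_sub_one_or_exists_mem_unipotentU_of_adj_of_ramified hσ hvσ hϖ heven hd h1d h2t A hA0 hA1 j hy) hxy

/-- **(H7e) AT A RAMIFIED QUADRATIC DATUM (tame or wild) — `edgeSet` form, unconditionally** (certificate by ★ B1's `…_succ_of_involution`, proof-irrelevant).  Conclusion VERBATIM = ★'s. [cite: BruhatTits1972, §10] [cite: Tits1979, §2.4] [cite: Serre1980Trees, II.1.1] -/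
theorem exists_mem_unipotentU_mapEdgeSet_apartmentEnum_eq_of_ramified (hσ : ∀ x, σ (σ x) = x) (hvσ : ∀ a, Valued.v (σ a) = Valued.v a) (hϖ : Valued.v ϖ = WithZero.exp (-1 : ℤ)) 
    (heven : ∀ x : K, σ x = x → x ≠ 0 → ∃ n : ℤ, Valued.v x = WithZero.exp (2 * n)) {d t : ℕ}
    (hd : Valued.v (ϖ - σ ϖ) = Valued.v ϖ ^ d) (h1d : 1 ≤ d) (h2t : Valued.v (2 : K) = Valued.v ϖ ^ t) [Finite 𝓀[K]]
    (A : ℤ → {M : Submodule 𝒪[K] (Fin 3 → K) // IsVertex σ ϖ ((StdForm.antidiagonal 3).over K) M})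
    (hA0 : ∀ a : ℤ, (A (2 * a)).1 = latt (Matrix.diagonal ![ϖ ^ a, (1 : K), ϖ ^ (-a)]))
    (hA1 : ∀ a : ℤ, (A (2 * a + 1)).1 = latt (Matrix.diagonal ![ϖ ^ (a + 1), (1 : K), ϖ ^ (-a)]))
    (e : (latticeGraph σ ϖ ((StdForm.antidiagonal 3).over K)).edgeSet) :
    ∃ n : unitaryGroupOfForm σ ((StdForm.antidiagonal 3).over K), n ∈ unipotentU σ ((StdForm.antidiagonal 3).over K) ∧ ∃ j : ℤ,
      (latticeGraphIso σ ϖ ((StdForm.antidiagonal 3).over K) n).mapEdgeSet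
          ⟨s(A j, A (j + 1)), (mem_edgeSet _).2 (latticeGraph_adj_apartmentEnum_succ_of_involution hσ hvσ hϖ A hA0 hA1 j)⟩ = e :=
  exists_mem_unipotentU_mapEdgeSet_apartmentEnum_eq_of_involution hσ hvσ hϖ A hA0 hA1 (isTree_latticeGraph_three_of_ramified hσ hvσ hϖ heven hd h1d h2t)
    (fun j _ hy => eq_apartmentEnum_sub_one_or_exists_mem_unipotentU_of_adj_of_ramified hσ hvσ hϖ heven hd h1d h2t A hA0 hA1 j hy) e

/-- **(H7!) AT A RAMIFIED QUADRATIC DATUM (tame or wild) — the apartment index of an edge is well defined.**  Conclusion VERBATIM = ★'s. [cite: BruhatTits1972, §10] [cite: Tits1979, §2.4] [cite: Serre1980Trees, II.1.1] -/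
theorem eq_of_mem_unipotentU_of_sym2Map_apartmentEnum_eq_of_ramified (hσ : ∀ x, σ (σ x) = x) (hvσ : ∀ a, Valued.v (σ a) = Valued.v a) (hϖ : Valued.v ϖ = WithZero.exp (-1 : ℤ)) 
    (heven : ∀ x : K, σ x = x → x ≠ 0 → ∃ n : ℤ, Valued.v x = WithZero.exp (2 * n)) {d t : ℕ}
    (hd : Valued.v (ϖ - σ ϖ) = Valued.v ϖ ^ d) (h1d : 1 ≤ d) (h2t : Valued.v (2 : K) = Valued.v ϖ ^ t) [Finite 𝓀[K]]
    (A : ℤ → {M : Submodule 𝒪[K] (Fin 3 → K) // IsVertex σ ϖ ((StdForm.antidiagonal 3).over K) M})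
    (hA0 : ∀ a : ℤ, (A (2 * a)).1 = latt (Matrix.diagonal ![ϖ ^ a, (1 : K), ϖ ^ (-a)]))
    (hA1 : ∀ a : ℤ, (A (2 * a + 1)).1 = latt (Matrix.diagonal ![ϖ ^ (a + 1), (1 : K), ϖ ^ (-a)]))
    {n : unitaryGroupOfForm σ ((StdForm.antidiagonal 3).over K)}
    (hn : n ∈ unipotentU σ ((StdForm.antidiagonal 3).over K)) {i j : ℤ}
    (h : Sym2.map (latticeGraphIso σ ϖ ((StdForm.antidiagonal 3).over K) n) s(A i, A (i + 1)) = s(A j, A (j + 1))) : i = j :=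
  eq_of_mem_unipotentU_of_sym2Map_apartmentEnum_eq_of_involution hσ hvσ hϖ A hA0 hA1 (isTree_latticeGraph_three_of_ramified hσ hvσ hϖ heven hd h1d h2t) hn h

/-- **(H7!₂) AT A RAMIFIED QUADRATIC DATUM (tame or wild) — two-element form.**  Conclusion VERBATIM = ★'s. [cite: BruhatTits1972, §10] [cite: Tits1979, §2.4] [cite: Serre1980Trees, II.1.1] -/
theorem eq_of_mem_unipotentU_of_sym2Map_apartmentEnum_eq₂_of_ramified (hσ : ∀ x, σ (σ x) = x) (hvσ : ∀ a, Valued.v (σ a) = Valued.v a) (hϖ : Valued.v ϖ = WithZero.exp (-1 : ℤ)) 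
    (heven : ∀ x : K, σ x = x → x ≠ 0 → ∃ n : ℤ, Valued.v x = WithZero.exp (2 * n)) {d t : ℕ}
    (hd : Valued.v (ϖ - σ ϖ) = Valued.v ϖ ^ d) (h1d : 1 ≤ d) (h2t : Valued.v (2 : K) = Valued.v ϖ ^ t) [Finite 𝓀[K]]
    (A : ℤ → {M : Submodule 𝒪[K] (Fin 3 → K) // IsVertex σ ϖ ((StdForm.antidiagonal 3).over K) M})
    (hA0 : ∀ a : ℤ, (A (2 * a)).1 = latt (Matrix.diagonal ![ϖ ^ a, (1 : K), ϖ ^ (-a)]))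
    (hA1 : ∀ a : ℤ, (A (2 * a + 1)).1 = latt (Matrix.diagonal ![ϖ ^ (a + 1), (1 : K), ϖ ^ (-a)]))
    {n n' : unitaryGroupOfForm σ ((StdForm.antidiagonal 3).over K)}
    (hn : n ∈ unipotentU σ ((StdForm.antidiagonal 3).over K)) (hn' : n' ∈ unipotentU σ ((StdForm.antidiagonal 3).over K)) {i j : ℤ}
    (h : Sym2.map (latticeGraphIso σ ϖ ((StdForm.antidiagonal 3).over K) n) s(A i, A (i + 1)) =
      Sym2.map (latticeGraphIso σ ϖ ((StdForm.antidiagonal 3).over K) n') s(A j, A (j + 1))) : i = j :=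
  eq_of_mem_unipotentU_of_sym2Map_apartmentEnum_eq₂_of_involution hσ hvσ hϖ A hA0 hA1 (isTree_latticeGraph_three_of_ramified hσ hvσ hϖ heven hd h1d h2t) hn hn' h

/-- **(H7!e) AT A RAMIFIED QUADRATIC DATUM (tame or wild) — `edgeSet` form of the uniqueness.**  Conclusion VERBATIM = ★'s. [cite: BruhatTits1972, §10] [cite: Tits1979, §2.4] [cite: Serre1980Trees, II.1.1] -/
theorem eq_of_mem_unipotentU_of_mapEdgeSet_apartmentEnum_eq_of_ramified (hσ : ∀ x, σ (σ x) = x) (hvσ : ∀ a, Valued.v (σ a) = Valued.v a) (hϖ : Valued.v ϖ = WithZero.exp (-1 : ℤ)) 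
    (heven : ∀ x : K, σ x = x → x ≠ 0 → ∃ n : ℤ, Valued.v x = WithZero.exp (2 * n)) {d t : ℕ}
    (hd : Valued.v (ϖ - σ ϖ) = Valued.v ϖ ^ d) (h1d : 1 ≤ d) (h2t : Valued.v (2 : K) = Valued.v ϖ ^ t) [Finite 𝓀[K]]
    (A : ℤ → {M : Submodule 𝒪[K] (Fin 3 → K) // IsVertex σ ϖ ((StdForm.antidiagonal 3).over K) M})
    (hA0 : ∀ a : ℤ, (A (2 * a)).1 = latt (Matrix.diagonal ![ϖ ^ a, (1 : K), ϖ ^ (-a)]))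
    (hA1 : ∀ a : ℤ, (A (2 * a + 1)).1 = latt (Matrix.diagonal ![ϖ ^ (a + 1), (1 : K), ϖ ^ (-a)]))
    {n n' : unitaryGroupOfForm σ ((StdForm.antidiagonal 3).over K)}
    (hn : n ∈ unipotentU σ ((StdForm.antidiagonal 3).over K)) (hn' : n' ∈ unipotentU σ ((StdForm.antidiagonal 3).over K)) {i j : ℤ}
    (h : (latticeGraphIso σ ϖ ((StdForm.antidiagonal 3).over K) n).mapEdgeSet
        ⟨s(A i, A (i + 1)), (mem_edgeSet _).2 (latticeGraph_adj_apartmentEnum_succ_of_involution hσ hvσ hϖ A hA0 hA1 i)⟩ =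
      (latticeGraphIso σ ϖ ((StdForm.antidiagonal 3).over K) n').mapEdgeSet
        ⟨s(A j, A (j + 1)), (mem_edgeSet _).2 (latticeGraph_adj_apartmentEnum_succ_of_involution hσ hvσ hϖ A hA0 hA1 j)⟩) : i = j :=
  eq_of_mem_unipotentU_of_mapEdgeSet_apartmentEnum_eq_of_involution hσ hvσ hϖ A hA0 hA1 (isTree_latticeGraph_three_of_ramified hσ hvσ hϖ heven hd h1d h2t) hn hn' h

/-! ### §2.4 (H8) BOREL STABILISERS at a ramified quadratic datum -/

/-- **(H8) AT A RAMIFIED QUADRATIC DATUM (tame or wild) — BOREL STABILISERS `B ∩ Stab(A j) = C · (N ∩ Stab(A j))`, UNCONDITIONALLY.**  Conclusion VERBATIM = ★'s.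
[cite: BruhatTits1972, §10] [cite: Tits1979, §2.4] [cite: Serre1980Trees, II.1.1; I.6.4] -/
theorem exists_torusU_mul_unipotentU_of_mem_borelU_of_latticeGraphIso_apartmentEnum_eq_of_ramified (hσ : ∀ x, σ (σ x) = x) (hvσ : ∀ a, Valued.v (σ a) = Valued.v a) (hϖ : Valued.v ϖ = WithZero.exp (-1 : ℤ)) 
    (heven : ∀ x : K, σ x = x → x ≠ 0 → ∃ n : ℤ, Valued.v x = WithZero.exp (2 * n)) {d t : ℕ}
    (hd : Valued.v (ϖ - σ ϖ) = Valued.v ϖ ^ d) (h1d : 1 ≤ d) (h2t : Valued.v (2 : K) = Valued.v ϖ ^ t) [Finite 𝓀[K]]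
    (A : ℤ → {M : Submodule 𝒪[K] (Fin 3 → K) // IsVertex σ ϖ ((StdForm.antidiagonal 3).over K) M})
    (hA0 : ∀ a : ℤ, (A (2 * a)).1 = latt (Matrix.diagonal ![ϖ ^ a, (1 : K), ϖ ^ (-a)]))
    (hA1 : ∀ a : ℤ, (A (2 * a + 1)).1 = latt (Matrix.diagonal ![ϖ ^ (a + 1), (1 : K), ϖ ^ (-a)]))
    {b : unitaryGroupOfForm σ ((StdForm.antidiagonal 3).over K)}
    (hb : b ∈ borelU σ ((StdForm.antidiagonal 3).over K)) {j : ℤ} (h : latticeGraphIso σ ϖ ((StdForm.antidiagonal 3).over K) b (A j) = A j) :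
    ∃ t n : unitaryGroupOfForm σ ((StdForm.antidiagonal 3).over K), t ∈ torusU σ ((StdForm.antidiagonal 3).over K) ∧
      t ∈ unitaryInt σ ((StdForm.antidiagonal 3).over K) ∧
      n ∈ unipotentU σ ((StdForm.antidiagonal 3).over K) ∧ b = t * n ∧
      (∃ d : Fin 3 → Kˣ, glDiagonal 3 K d = (t : GL (Fin 3) K) ∧ ∀ i, Valued.v (d i : K) = 1) ∧
      (∀ k : ℤ, latticeGraphIso σ ϖ ((StdForm.antidiagonal 3).over K) t (A k) = A k) ∧
      latticeGraphIso σ ϖ ((StdForm.antidiagonal 3).over K) n (A j) = A j :=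
  exists_torusU_mul_unipotentU_of_mem_borelU_of_latticeGraphIso_apartmentEnum_eq_of_involution hσ hvσ hϖ A hA0 hA1 (isTree_latticeGraph_three_of_ramified hσ hvσ hϖ heven hd h1d h2t) hb h

/-! ## §3 Vertex and edge orbit data at a ramified quadratic datum (★ `…OrbitsViaApartmentOfInvolution` §5 re-lettered) -/

/-- **AT A RAMIFIED QUADRATIC DATUM (tame or wild) — EVERY VERTEX IS `u · A 0` OR `u · A 1`, UNCONDITIONALLY** (`hT` ↦ ★ `isTree_latticeGraph_three_of_ramified`, `hH4` ↦ (S)-ram `…_of_adj_of_ramified`).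
Conclusion VERBATIM = ★'s; the wild token pass is `hd ↦ hσ hvσ hϖ heven hd h1d h2t`. [cite: BruhatTits1972, §10, (4.4.4)] [cite: Tits1979, §2.4] [cite: Serre1980Trees, II.1.1] -/
theorem exists_latticeGraphIso_apartmentEnum_zero_eq_or_one_eq_of_ramified (hσ : ∀ x, σ (σ x) = x) (hvσ : ∀ a, Valued.v (σ a) = Valued.v a) (hϖ : Valued.v ϖ = WithZero.exp (-1 : ℤ)) 
    (heven : ∀ x : K, σ x = x → x ≠ 0 → ∃ n : ℤ, Valued.v x = WithZero.exp (2 * n)) {d t : ℕ}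
    (hd : Valued.v (ϖ - σ ϖ) = Valued.v ϖ ^ d) (h1d : 1 ≤ d) (h2t : Valued.v (2 : K) = Valued.v ϖ ^ t) [Finite 𝓀[K]]
    (A : ℤ → {M : Submodule 𝒪[K] (Fin 3 → K) // IsVertex σ ϖ ((StdForm.antidiagonal 3).over K) M})
    (hA0 : ∀ a : ℤ, (A (2 * a)).1 = latt (Matrix.diagonal ![ϖ ^ a, (1 : K), ϖ ^ (-a)]))
    (hA1 : ∀ a : ℤ, (A (2 * a + 1)).1 = latt (Matrix.diagonal ![ϖ ^ (a + 1), (1 : K), ϖ ^ (-a)]))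
    (x : {M : Submodule 𝒪[K] (Fin 3 → K) // IsVertex σ ϖ ((StdForm.antidiagonal 3).over K) M}) :
    ∃ u : unitaryGroupOfForm σ ((StdForm.antidiagonal 3).over K),
      latticeGraphIso σ ϖ ((StdForm.antidiagonal 3).over K) u (A 0) = x ∨ latticeGraphIso σ ϖ ((StdForm.antidiagonal 3).over K) u (A 1) = x :=
  exists_latticeGraphIso_apartmentEnum_zero_eq_or_one_eq_of_involution hσ hvσ hϖ A hA0 hA1 (isTree_latticeGraph_three_of_ramified hσ hvσ hϖ heven hd h1d h2t)
    (fun j _ hy => eq_apartmentEnum_sub_one_or_exists_mem_unipotentU_of_adj_of_ramified hσ hvσ hϖ heven hd h1d h2t A hA0 hA1 j hy) x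

/-- **AT A RAMIFIED QUADRATIC DATUM (tame or wild) — `U` IS TRANSITIVE ON THE EDGES, UNCONDITIONALLY.**  Conclusion VERBATIM = ★ `exists_latticeGraphIso_sym2Map_apartmentEnum_zero_one_eq_of_adj`'s.
[cite: BruhatTits1972, §10, (4.4.4)] [cite: Tits1979, §2.4] [cite: Serre1980Trees, II.1.1] -/
theorem exists_latticeGraphIso_sym2Map_apartmentEnum_zero_one_eq_of_adj_of_ramified (hσ : ∀ x, σ (σ x) = x) (hvσ : ∀ a, Valued.v (σ a) = Valued.v a) (hϖ : Valued.v ϖ = WithZero.exp (-1 : ℤ)) 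
    (heven : ∀ x : K, σ x = x → x ≠ 0 → ∃ n : ℤ, Valued.v x = WithZero.exp (2 * n)) {d t : ℕ}
    (hd : Valued.v (ϖ - σ ϖ) = Valued.v ϖ ^ d) (h1d : 1 ≤ d) (h2t : Valued.v (2 : K) = Valued.v ϖ ^ t) [Finite 𝓀[K]]
    (A : ℤ → {M : Submodule 𝒪[K] (Fin 3 → K) // IsVertex σ ϖ ((StdForm.antidiagonal 3).over K) M})
    (hA0 : ∀ a : ℤ, (A (2 * a)).1 = latt (Matrix.diagonal ![ϖ ^ a, (1 : K), ϖ ^ (-a)]))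
    (hA1 : ∀ a : ℤ, (A (2 * a + 1)).1 = latt (Matrix.diagonal ![ϖ ^ (a + 1), (1 : K), ϖ ^ (-a)]))
    {x y : {M : Submodule 𝒪[K] (Fin 3 → K) // IsVertex σ ϖ ((StdForm.antidiagonal 3).over K) M}}
    (hxy : (latticeGraph σ ϖ ((StdForm.antidiagonal 3).over K)).Adj x y) :
    ∃ u : unitaryGroupOfForm σ ((StdForm.antidiagonal 3).over K), Sym2.map (latticeGraphIso σ ϖ ((StdForm.antidiagonal 3).over K) u) s(A 0, A 1) = s(x, y) :=
  exists_latticeGraphIso_sym2Map_apartmentEnum_zero_one_eq_of_adj_of_involution hσ hvσ hϖ A hA0 hA1 (isTree_latticeGraph_three_of_ramified hσ hvσ hϖ heven hd h1d h2t)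
    (fun j _ hy => eq_apartmentEnum_sub_one_or_exists_mem_unipotentU_of_adj_of_ramified hσ hvσ hϖ heven hd h1d h2t A hA0 hA1 j hy) hxy

/-- **AT A RAMIFIED QUADRATIC DATUM (tame or wild) — oriented-or form, unconditionally.**  Conclusion VERBATIM = ★ `exists_latticeGraphIso_apartmentEnum_zero_one_eq_of_adj`'s. [cite: BruhatTits1972, §10, (4.4.4)] [cite: Tits1979, §2.4] [cite: Serre1980Trees, II.1.1] -/
theorem exists_latticeGraphIso_apartmentEnum_zero_one_eq_of_adj_of_ramified (hσ : ∀ x, σ (σ x) = x) (hvσ : ∀ a, Valued.v (σ a) = Valued.v a) (hϖ : Valued.v ϖ = WithZero.exp (-1 : ℤ)) 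
    (heven : ∀ x : K, σ x = x → x ≠ 0 → ∃ n : ℤ, Valued.v x = WithZero.exp (2 * n)) {d t : ℕ}
    (hd : Valued.v (ϖ - σ ϖ) = Valued.v ϖ ^ d) (h1d : 1 ≤ d) (h2t : Valued.v (2 : K) = Valued.v ϖ ^ t) [Finite 𝓀[K]]
    (A : ℤ → {M : Submodule 𝒪[K] (Fin 3 → K) // IsVertex σ ϖ ((StdForm.antidiagonal 3).over K) M})
    (hA0 : ∀ a : ℤ, (A (2 * a)).1 = latt (Matrix.diagonal ![ϖ ^ a, (1 : K), ϖ ^ (-a)]))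
    (hA1 : ∀ a : ℤ, (A (2 * a + 1)).1 = latt (Matrix.diagonal ![ϖ ^ (a + 1), (1 : K), ϖ ^ (-a)]))
    {x y : {M : Submodule 𝒪[K] (Fin 3 → K) // IsVertex σ ϖ ((StdForm.antidiagonal 3).over K) M}}
    (hxy : (latticeGraph σ ϖ ((StdForm.antidiagonal 3).over K)).Adj x y) :
    ∃ u : unitaryGroupOfForm σ ((StdForm.antidiagonal 3).over K),
      (latticeGraphIso σ ϖ ((StdForm.antidiagonal 3).over K) u (A 0) = x ∧ latticeGraphIso σ ϖ ((StdForm.antidiagonal 3).over K) u (A 1) = y) ∨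
      (latticeGraphIso σ ϖ ((StdForm.antidiagonal 3).over K) u (A 0) = y ∧ latticeGraphIso σ ϖ ((StdForm.antidiagonal 3).over K) u (A 1) = x) :=
  exists_latticeGraphIso_apartmentEnum_zero_one_eq_of_adj_of_involution hσ hvσ hϖ A hA0 hA1 (isTree_latticeGraph_three_of_ramified hσ hvσ hϖ heven hd h1d h2t)
    (fun j _ hy => eq_apartmentEnum_sub_one_or_exists_mem_unipotentU_of_adj_of_ramified hσ hvσ hϖ heven hd h1d h2t A hA0 hA1 j hy) hxy

/-- **AT A RAMIFIED QUADRATIC DATUM (tame or wild) — `edgeSet` form, unconditionally.**  Conclusion VERBATIM = ★ `exists_latticeGraphIso_mapEdgeSet_apartmentEnum_zero_one_eq`'s. [cite: BruhatTits1972, §10, (4.4.4)] [cite: Tits1979, §2.4] [cite: Serre1980Trees, II.1.1] -/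
theorem exists_latticeGraphIso_mapEdgeSet_apartmentEnum_zero_one_eq_of_ramified (hσ : ∀ x, σ (σ x) = x) (hvσ : ∀ a, Valued.v (σ a) = Valued.v a) (hϖ : Valued.v ϖ = WithZero.exp (-1 : ℤ)) 
    (heven : ∀ x : K, σ x = x → x ≠ 0 → ∃ n : ℤ, Valued.v x = WithZero.exp (2 * n)) {d t : ℕ}
    (hd : Valued.v (ϖ - σ ϖ) = Valued.v ϖ ^ d) (h1d : 1 ≤ d) (h2t : Valued.v (2 : K) = Valued.v ϖ ^ t) [Finite 𝓀[K]]
    (A : ℤ → {M : Submodule 𝒪[K] (Fin 3 → K) // IsVertex σ ϖ ((StdForm.antidiagonal 3).over K) M})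
    (hA0 : ∀ a : ℤ, (A (2 * a)).1 = latt (Matrix.diagonal ![ϖ ^ a, (1 : K), ϖ ^ (-a)]))
    (hA1 : ∀ a : ℤ, (A (2 * a + 1)).1 = latt (Matrix.diagonal ![ϖ ^ (a + 1), (1 : K), ϖ ^ (-a)]))
    (e : (latticeGraph σ ϖ ((StdForm.antidiagonal 3).over K)).edgeSet) :
    ∃ u : unitaryGroupOfForm σ ((StdForm.antidiagonal 3).over K),
      (latticeGraphIso σ ϖ ((StdForm.antidiagonal 3).over K) u).mapEdgeSet
          ⟨s(A 0, A 1), (mem_edgeSet _).2 (by simpa using latticeGraph_adj_apartmentEnum_succ_of_involution hσ hvσ hϖ A hA0 hA1 0)⟩ = e :=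
  exists_latticeGraphIso_mapEdgeSet_apartmentEnum_zero_one_eq_of_involution hσ hvσ hϖ A hA0 hA1 (isTree_latticeGraph_three_of_ramified hσ hvσ hϖ heven hd h1d h2t)
    (fun j _ hy => eq_apartmentEnum_sub_one_or_exists_mem_unipotentU_of_adj_of_ramified hσ hvσ hϖ heven hd h1d h2t A hA0 hA1 j hy) e

/-- **AT A RAMIFIED QUADRATIC DATUM (tame or wild) — VERTEX ORBIT DATA, UNCONDITIONALLY** (two vertex orbits; the letters `xv idx₀ tr₀ hidx₀ hidx₀a htr₀` of the datum file B).  Conclusion VERBATIM =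
★ `exists_vertexOrbitData`'s. [cite: BruhatTits1972, §10, (4.4.4)] [cite: Tits1979, §2.4] [cite: Serre1980Trees, II.1.1] -/
theorem exists_vertexOrbitData_of_ramified (hσ : ∀ x, σ (σ x) = x) (hvσ : ∀ a, Valued.v (σ a) = Valued.v a) (hϖ : Valued.v ϖ = WithZero.exp (-1 : ℤ)) 
    (heven : ∀ x : K, σ x = x → x ≠ 0 → ∃ n : ℤ, Valued.v x = WithZero.exp (2 * n)) {d t : ℕ}
    (hd : Valued.v (ϖ - σ ϖ) = Valued.v ϖ ^ d) (h1d : 1 ≤ d) (h2t : Valued.v (2 : K) = Valued.v ϖ ^ t) [Finite 𝓀[K]]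
    (A : ℤ → {M : Submodule 𝒪[K] (Fin 3 → K) // IsVertex σ ϖ ((StdForm.antidiagonal 3).over K) M})
    (hA0 : ∀ a : ℤ, (A (2 * a)).1 = latt (Matrix.diagonal ![ϖ ^ a, (1 : K), ϖ ^ (-a)]))
    (hA1 : ∀ a : ℤ, (A (2 * a + 1)).1 = latt (Matrix.diagonal ![ϖ ^ (a + 1), (1 : K), ϖ ^ (-a)])) :
    ∃ (idx₀ : {M : Submodule 𝒪[K] (Fin 3 → K) // IsVertex σ ϖ ((StdForm.antidiagonal 3).over K) M} → Fin 2)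
      (tr₀ : {M : Submodule 𝒪[K] (Fin 3 → K) // IsVertex σ ϖ ((StdForm.antidiagonal 3).over K) M} → unitaryGroupOfForm σ ((StdForm.antidiagonal 3).over K)),
      (∀ i : Fin 2, idx₀ (![A 0, A 1] i) = i) ∧
      (∀ (g : unitaryGroupOfForm σ ((StdForm.antidiagonal 3).over K)) (x : {M : Submodule 𝒪[K] (Fin 3 → K) // IsVertex σ ϖ ((StdForm.antidiagonal 3).over K) M}),
          idx₀ (latticeGraphIso σ ϖ ((StdForm.antidiagonal 3).over K) g x) = idx₀ x) ∧
      ∀ x : {M : Submodule 𝒪[K] (Fin 3 → K) // IsVertex σ ϖ ((StdForm.antidiagonal 3).over K) M},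
        latticeGraphIso σ ϖ ((StdForm.antidiagonal 3).over K) (tr₀ x) (![A 0, A 1] (idx₀ x)) = x :=
  exists_vertexOrbitData_of_involution hσ hvσ hϖ A hA0 hA1 (isTree_latticeGraph_three_of_ramified hσ hvσ hϖ heven hd h1d h2t)
    (fun j _ hy => eq_apartmentEnum_sub_one_or_exists_mem_unipotentU_of_adj_of_ramified hσ hvσ hϖ heven hd h1d h2t A hA0 hA1 j hy)

/-- **AT A RAMIFIED QUADRATIC DATUM (tame or wild) — EDGE ORBIT DATA, UNCONDITIONALLY** (one edge orbit).  Conclusion VERBATIM = ★ `exists_edgeOrbitData`'s. [cite: BruhatTits1972, §10, (4.4.4)] [cite: Tits1979, §2.4] [cite: Serre1980Trees, II.1.1] -/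
theorem exists_edgeOrbitData_of_ramified (hσ : ∀ x, σ (σ x) = x) (hvσ : ∀ a, Valued.v (σ a) = Valued.v a) (hϖ : Valued.v ϖ = WithZero.exp (-1 : ℤ)) 
    (heven : ∀ x : K, σ x = x → x ≠ 0 → ∃ n : ℤ, Valued.v x = WithZero.exp (2 * n)) {d t : ℕ}
    (hd : Valued.v (ϖ - σ ϖ) = Valued.v ϖ ^ d) (h1d : 1 ≤ d) (h2t : Valued.v (2 : K) = Valued.v ϖ ^ t) [Finite 𝓀[K]]
    (A : ℤ → {M : Submodule 𝒪[K] (Fin 3 → K) // IsVertex σ ϖ ((StdForm.antidiagonal 3).over K) M})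
    (hA0 : ∀ a : ℤ, (A (2 * a)).1 = latt (Matrix.diagonal ![ϖ ^ a, (1 : K), ϖ ^ (-a)]))
    (hA1 : ∀ a : ℤ, (A (2 * a + 1)).1 = latt (Matrix.diagonal ![ϖ ^ (a + 1), (1 : K), ϖ ^ (-a)])) :
    ∃ tr₁ : (latticeGraph σ ϖ ((StdForm.antidiagonal 3).over K)).edgeSet → unitaryGroupOfForm σ ((StdForm.antidiagonal 3).over K),
      ∀ e, (latticeGraphIso σ ϖ ((StdForm.antidiagonal 3).over K) (tr₁ e)).mapEdgeSet
          ⟨s(A 0, A 1), (mem_edgeSet _).2 (by simpa using latticeGraph_adj_apartmentEnum_succ_of_involution hσ hvσ hϖ A hA0 hA1 0)⟩ = e :=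
  exists_edgeOrbitData_of_involution hσ hvσ hϖ A hA0 hA1 (isTree_latticeGraph_three_of_ramified hσ hvσ hϖ heven hd h1d h2t)
    (fun j _ hy => eq_apartmentEnum_sub_one_or_exists_mem_unipotentU_of_adj_of_ramified hσ hvσ hϖ heven hd h1d h2t A hA0 hA1 j hy)

end Sheet

end Literature.NumberTheory.Automorphic.UnitaryLatticeTree

/-! ## §4 The datum token's shape (`IsRamifiedQuadraticDatum` lives at `K : Type`) -/

namespace Literature.NumberTheory.Automorphic.UnitaryLatticeTree

open _root_.SimpleGraph Literature.NumberTheory.Automorphic Literature.NumberTheory.Automorphic.HermitianLattice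
open Literature.NumberTheory.Automorphic.UnitaryGroup
open Literature.NumberTheory.Automorphic.UnitaryThreeFourFrame

variable {K : Type} [Field K] [Valued K ℤᵐ⁰] {σ : K →+* K} {ϖ : K}

/-- **(S) IN THE DATUM TOKEN'S SHAPE**: the star dichotomy at every apartment vertex, at every ramified quadratic datum with finite residue field — the `hH4` binder of the
`_of_involution` layer, U0 currency. [cite: BruhatTits1972, (4.4.4) and §10] [cite: Tits1979, §2.7 (p. 48)] [cite: Serre1980Trees, II.1.1] -/
theorem eq_apartmentEnum_sub_one_or_exists_mem_unipotentU_of_adj_of_isRamifiedQuadraticDatum [Finite 𝓀[K]] {d t : ℕ} (hD : IsRamifiedQuadraticDatum σ ϖ d t)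
    (A : ℤ → {M : Submodule 𝒪[K] (Fin 3 → K) // IsVertex σ ϖ ((StdForm.antidiagonal 3).over K) M})
    (hA0 : ∀ a : ℤ, (A (2 * a)).1 = latt (Matrix.diagonal ![ϖ ^ a, (1 : K), ϖ ^ (-a)]))
    (hA1 : ∀ a : ℤ, (A (2 * a + 1)).1 = latt (Matrix.diagonal ![ϖ ^ (a + 1), (1 : K), ϖ ^ (-a)]))
    (j : ℤ)
    {y : {M : Submodule 𝒪[K] (Fin 3 → K) // IsVertex σ ϖ ((StdForm.antidiagonal 3).over K) M}}
    (hy : (latticeGraph σ ϖ ((StdForm.antidiagonal 3).over K)).Adj (A j) y) :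
    y = A (j - 1) ∨ ∃ n : unitaryGroupOfForm σ ((StdForm.antidiagonal 3).over K), n ∈ unipotentU σ ((StdForm.antidiagonal 3).over K) ∧
      latticeGraphIso σ ϖ ((StdForm.antidiagonal 3).over K) n (A j) = A j ∧ latticeGraphIso σ ϖ ((StdForm.antidiagonal 3).over K) n (A (j + 1)) = y :=
  eq_apartmentEnum_sub_one_or_exists_mem_unipotentU_of_adj_of_ramified hD.1 hD.2.1 hD.2.2.1 hD.2.2.2.1 hD.2.2.2.2.1 hD.2.2.2.2.2.1 hD.2.2.2.2.2.2 A hA0 hA1 j hy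

variable [ValuativeRel K] [(Valued.v : Valuation K ℤᵐ⁰).Compatible]

/-- **VERTEX ORBIT DATA IN THE DATUM TOKEN'S SHAPE** (two vertex orbits `U·A 0`, `U·A 1` with an invariant type index and translators): §3's `exists_vertexOrbitData_of_ramified` at
`hD : IsRamifiedQuadraticDatum σ ϖ d t` — the `(idx₀, tr₀)` input of the (A)-datum file of the EP tower. [cite: BruhatTits1972, §10, (4.4.4)] [cite: Serre1980Trees, II.1.1] -/
theorem exists_vertexOrbitData_of_isRamifiedQuadraticDatum [Finite 𝓀[K]] {d t : ℕ} (hD : IsRamifiedQuadraticDatum σ ϖ d t)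
    (A : ℤ → {M : Submodule 𝒪[K] (Fin 3 → K) // IsVertex σ ϖ ((StdForm.antidiagonal 3).over K) M})
    (hA0 : ∀ a : ℤ, (A (2 * a)).1 = latt (Matrix.diagonal ![ϖ ^ a, (1 : K), ϖ ^ (-a)]))
    (hA1 : ∀ a : ℤ, (A (2 * a + 1)).1 = latt (Matrix.diagonal ![ϖ ^ (a + 1), (1 : K), ϖ ^ (-a)])) :
    ∃ (idx₀ : {M : Submodule 𝒪[K] (Fin 3 → K) // IsVertex σ ϖ ((StdForm.antidiagonal 3).over K) M} → Fin 2)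
      (tr₀ : {M : Submodule 𝒪[K] (Fin 3 → K) // IsVertex σ ϖ ((StdForm.antidiagonal 3).over K) M} → unitaryGroupOfForm σ ((StdForm.antidiagonal 3).over K)),
      (∀ i : Fin 2, idx₀ (![A 0, A 1] i) = i) ∧
      (∀ (g : unitaryGroupOfForm σ ((StdForm.antidiagonal 3).over K)) (x : {M : Submodule 𝒪[K] (Fin 3 → K) // IsVertex σ ϖ ((StdForm.antidiagonal 3).over K) M}),
          idx₀ (latticeGraphIso σ ϖ ((StdForm.antidiagonal 3).over K) g x) = idx₀ x) ∧
      ∀ x : {M : Submodule 𝒪[K] (Fin 3 → K) // IsVertex σ ϖ ((StdForm.antidiagonal 3).over K) M},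
        latticeGraphIso σ ϖ ((StdForm.antidiagonal 3).over K) (tr₀ x) (![A 0, A 1] (idx₀ x)) = x :=
  exists_vertexOrbitData_of_ramified hD.1 hD.2.1 hD.2.2.1 hD.2.2.2.1 hD.2.2.2.2.1 hD.2.2.2.2.2.1 hD.2.2.2.2.2.2 A hA0 hA1

/-- **EDGE ORBIT DATA IN THE DATUM TOKEN'S SHAPE** (one edge orbit `U·{A 0, A 1}` with translators): §3's `exists_edgeOrbitData_of_ramified` at `hD : IsRamifiedQuadraticDatum σ ϖ d t`
— the `tr₁` input of the (A)-datum file of the EP tower. [cite: BruhatTits1972, §10, (4.4.4)] [cite: Serre1980Trees, II.1.1] -/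
theorem exists_edgeOrbitData_of_isRamifiedQuadraticDatum [Finite 𝓀[K]] {d t : ℕ} (hD : IsRamifiedQuadraticDatum σ ϖ d t)
    (A : ℤ → {M : Submodule 𝒪[K] (Fin 3 → K) // IsVertex σ ϖ ((StdForm.antidiagonal 3).over K) M})
    (hA0 : ∀ a : ℤ, (A (2 * a)).1 = latt (Matrix.diagonal ![ϖ ^ a, (1 : K), ϖ ^ (-a)]))
    (hA1 : ∀ a : ℤ, (A (2 * a + 1)).1 = latt (Matrix.diagonal ![ϖ ^ (a + 1), (1 : K), ϖ ^ (-a)])) :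
    ∃ tr₁ : (latticeGraph σ ϖ ((StdForm.antidiagonal 3).over K)).edgeSet → unitaryGroupOfForm σ ((StdForm.antidiagonal 3).over K),
      ∀ e, (latticeGraphIso σ ϖ ((StdForm.antidiagonal 3).over K) (tr₁ e)).mapEdgeSet
          ⟨s(A 0, A 1), (mem_edgeSet _).2 (by simpa using latticeGraph_adj_apartmentEnum_succ_of_involution hD.1 hD.2.1 hD.2.2.1 A hA0 hA1 0)⟩ = e :=
  exists_edgeOrbitData_of_ramified hD.1 hD.2.1 hD.2.2.1 hD.2.2.2.1 hD.2.2.2.2.1 hD.2.2.2.2.2.1 hD.2.2.2.2.2.2 A hA0 hA1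

end Literature.NumberTheory.Automorphic.UnitaryLatticeTree

end
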